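import Mathlib
import HarnessLib
import Summits.Ventures.LatticeQCDFlow.Scaling.EliminationFrontTorus
import Summits.Ventures.LatticeQCDFlow.Scaling.EliminationFrontRaster
import Summits.Ventures.LatticeQCDFlow.Scaling.StieltjesCholeskyFill

/-!
# LatticeQCDFlow / Scaling — THE AUTOREGRESSIVE-CONTEXT VOLUME LAW: an exact autoregressive
# sampler of the lattice free field on `(ℤ/L)^d`, in ANY site order, has a site whose conditional
# law reads `≥ c_d·L^{d-1}` previously generated sites

HONEST FRAMING: exact (Metropolis-corrected) sampling algorithms for lattice gauge theory;
figures of merit are autocorrelation/cost numbers at stated couplings and volumes; no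
continuum-physics claim.

Venture `LatticeQCDFlow` (cell pub-lqcd), topic `Scaling`, FANOUT row 30 (lean-1) — OUR WORK, file 6
(assembly) of the AUTOREGRESSIVE-CONTEXT (ELIMINATION-FRONT) VOLUME LAW (THEORY-2.md §4 row T2-AF
(b)/(d): "Gaussian targets …: in EVERY ordering some component needs context `≥ tw(G)`, and
`tw((ℤ/L)^d) ≥ L`"; "total context `≥ … V^{…}` in every ordering" — both typed and PROVED here for
the massive free field, with `tw ≥ c_d·L^{d-1}`).

THE SAMPLER.  A centred Gaussian vector `x` with positive-definite PRECISION `Q = L·diag(d)·Lᵀ`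
(`L` unit lower triangular for a linear order of the sites — THE Cholesky factorisation, unique:
`StieltjesCholeskyFill.ldl_unique_real`) has density `∝ exp(-½ xᵀQx)` and
**`quadForm_ldl_eq`**: `xᵀ Q x = Σ_a d_a · (x_a + Σ_{i ≻ a} L_{ia} x_i)²`, so
`exp(-½ xᵀQx) = Π_a exp(-½ d_a (x_a - μ_a)²)` with `μ_a = -Σ_{i ≻ a} L_{ia} x_i` a function of the
sites ABOVE `a` only, each factor a Gaussian probability kernel in `x_a` of variance `1/d_a`
(`integral_gaussianKernel`: `∫ exp(-½ d (t - μ)²) dt = √(2π/d)` whatever `μ`): generating the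
sites from the largest down, `x_a | x_{≻ a} ~ N(μ_a, 1/d_a)` — this IS the exact autoregressive
(Knothe–Rosenblatt, triangular, "masked/causal") sampler in that order, and the CONTEXT of site `a`
(the earlier sites its conditional law actually reads) is `{i ≻ a | L_{ia} ≠ 0}`.

THE TARGET.  `freeFieldPrecision d L m = -Δ + m²` on the torus `(ℤ/L)^d` (graph Laplacian of
`torusGraph d L` plus `m² · 1`, `m ≠ 0`): positive definite, a Z-matrix (STIELTJES), graph = the
torus graph (`matrixGraph_freeFieldPrecision`).

THE ABSTRACT LAW (**`stieltjes_context_law_of_isoperimetry`**): any finite connected graph, any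
Stieltjes precision with that graph, any order — max context `≥` the isoperimetric constant of the
balanced range, and a clique of that size.  THE TORUS LAW (**`freeField_context_law`**, `d ≥ 2`, `L ≥ 2`, `m ≠ 0`, EVERY linear order of the sites;
`c_d = isoConst d (1/(8d))`, `c_2 = 1/32`, `c_3 = 1/192`, `c_4 = 1/1536`): the Cholesky factor has
`L_{ia} ≤ 0` (conditional means are NON-NEGATIVE combinations of the context values), the context of
`a` is EXACTLY its higher fill-neighbourhood in the elimination graph of the torus (no cancellation,
`StieltjesCholeskyFill.stieltjes_ldl`), hence (`EliminationFrontTorus.torus_le_elimWidth`)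
**some site has context of size `≥ c_d·L^{d-1}`**, and (`torus_exists_isClique_elimGraph`) there are
`≥ c_d·L^{d-1}` sites EVERY earlier-generated one of which lies in the context of every later one —
`≥ ½ c_d L^{d-1} (c_d L^{d-1} - 1)` (site, context-site) dependencies, superlinear in the volume for
`d ≥ 3`; and (**`freeField_context_foldedRaster_le`**, `Scaling/EliminationFrontRaster.lean`) the
folded raster order achieves context `≤ 2·L^{d-1}` at every site — the law is `Θ(L^{d-1})`.  No
ordering, masking or architecture avoids it; a model whose conditionals read fewer
sites is not exact for the free field, let alone (conjecture C5, THEORY-2.md) for interacting or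
gauge targets.  Elementary given the previous files; nothing is cited as a fact;
`def freeFieldPrecision`; no `sorry`.
-/

noncomputable section

namespace Summit.Ventures.LatticeQCDFlow.Theory2.Autoregressive

open Matrix Finset MeasureTheory
open Literature.LinearAlgebra.Matrix (IsZMatrix)
open Literature.LinearAlgebra.Matrix.ChordalSparsity
open Literature.Combinatorics.SimpleGraph
open Literature.Probability.LatticeModels (TorusSite torusGraph torusGraph_adj_iff)

/-! ## 1. The autoregressive reading of `Q = L diag(d) Lᵀ` -/

section Gaussian

variable {ι : Type*} [Fintype ι] [LinearOrder ι]

/-- `(Lᵀ x)_a = x_a + Σ_{i ≻ a} L_{ia} x_i` for a unit lower triangular `L`. [folklore] -/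
theorem transpose_mulVec_unitLower {L : Matrix ι ι ℝ} (hL : IsUnitLowerTriangular L) (x : ι → ℝ)
    (a : ι) : (Lᵀ *ᵥ x) a = x a + ∑ i ∈ univ.filter (fun i => a < i), L i a * x i := by
  classical
  rw [Matrix.mulVec, dotProduct]
  simp only [Matrix.transpose_apply]
  rw [← Finset.sum_filter_add_sum_filter_not univ (fun i => a < i)]
  rw [add_comm]
  congr 1
  -- the indices `i` with `¬ a < i`: only `i = a` contributes (`L i a = 0` for `i < a`)
  rw [Finset.sum_eq_single_of_mem a (by simp)]
  · rw [hL.2 a, one_mul]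
  · intro i hi hia
    have hia' : i < a := lt_of_le_of_ne (not_lt.mp (Finset.mem_filter.mp hi).2) hia
    rw [hL.1 (OrderDual.toDual_lt_toDual.mpr hia'), zero_mul]

/-- **THE AUTOREGRESSIVE FACTORISATION OF A GAUSSIAN**: for `Q = L·diag(d)·Lᵀ` with `L` unit lower
triangular, `xᵀ Q x = Σ_a d_a (x_a + Σ_{i ≻ a} L_{ia} x_i)²` — `exp(-½xᵀQx)` is the product over the
sites `a` of Gaussian kernels in `x_a` centred at `-Σ_{i ≻ a} L_{ia} x_i`, precision `d_a`.
[folklore] -/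
theorem quadForm_ldl_eq {L : Matrix ι ι ℝ} (hL : IsUnitLowerTriangular L) (d : ι → ℝ)
    (x : ι → ℝ) :
    x ⬝ᵥ ((L * diagonal d * Lᵀ) *ᵥ x) =
      ∑ a, d a * (x a + ∑ i ∈ univ.filter (fun i => a < i), L i a * x i) ^ 2 := by
  classical
  rw [← Matrix.mulVec_mulVec, ← Matrix.mulVec_mulVec, Matrix.dotProduct_mulVec,
    ← Matrix.mulVec_transpose, dotProduct]
  refine Finset.sum_congr rfl fun a _ => ?_
  rw [Matrix.mulVec_diagonal, transpose_mulVec_unitLower hL x a]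
  ring

/-- Normalisation of the Gaussian kernel: `∫ exp(-(d/2)(t - μ)²) dt = √(2π/d)` for `d > 0`, whatever
the centre `μ` — each factor of the autoregressive factorisation is a probability law in its own
variable. [folklore] -/
theorem integral_gaussianKernel {d : ℝ} (hd : 0 < d) (μ : ℝ) :
    ∫ t : ℝ, Real.exp (-(d / 2) * (t - μ) ^ 2) = Real.sqrt (2 * Real.pi / d) := by
  rw [MeasureTheory.integral_sub_right_eq_self (fun t => Real.exp (-(d / 2) * t ^ 2)) μ,
    integral_gaussian]
  congr 1
  field_simp

end Gaussian

/-! ## 1b. The abstract law: any graph, any Stieltjes precision, any order -/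

section Abstract

variable {ι : Type*} [Fintype ι] [LinearOrder ι]

/-- **THE AUTOREGRESSIVE-CONTEXT LAW ON AN ARBITRARY GRAPH.**  Let `X` be a real positive-definite
Z-matrix (a Stieltjes precision) whose graph is connected on `n ≥ 3` indices with neighbourhoods
of size `≤ Δ`, and suppose every index set `A` in the balanced range (`n ≤ 2Δ·#A + 2`, `2#A < n`)
has `≥ w` outer-boundary vertices.  Then for the linear order of `ι` — ANY order — the Cholesky
factorisation `X = L·diag(d)·Lᵀ` (the exact autoregressive sampler of `N(0, X⁻¹)` generating the
largest index first) has `L ≤ 0` off the diagonal, SOME index `a` with context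
`#{i ≻ a | L i a ≠ 0} ≥ w`, and a set `K` of `≥ w` indices with `L i a < 0` for all `a ≺ i` in `K`.
(The torus is the instance `w = c_d·L^{d-1}` below; other lattices, boxes with free boundary or
coarse graphs of hierarchical schemes enter through their own isoperimetric constant.) [folklore] -/
theorem stieltjes_context_law_of_isoperimetry {X : Matrix ι ι ℝ} (hX : X.PosDef) (hZ : IsZMatrix X)
    (hconn : (matrixGraph X).Connected) (Δ w : ℕ)
    (hΔ : ∀ v, ((matrixGraph X).neighborSet v).ncard ≤ Δ) (h3 : 3 ≤ Fintype.card ι)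
    (hiso : ∀ A : Set ι, Fintype.card ι ≤ 2 * Δ * A.ncard + 2 → 2 * A.ncard < Fintype.card ι →
      w ≤ (outer (matrixGraph X) A).ncard) :
    ∃ (L : Matrix ι ι ℝ) (d : ι → ℝ), IsUnitLowerTriangular L ∧ (∀ a, 0 < d a) ∧
      X = L * diagonal d * Lᵀ ∧ (∀ i a, i ≠ a → L i a ≤ 0) ∧
      (∃ a, w ≤ ({i | a < i ∧ L i a ≠ 0} : Set ι).ncard) ∧
      (∃ K : Finset ι, w ≤ K.card ∧ ∀ a ∈ K, ∀ i ∈ K, a < i → L i a < 0) := by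
  classical
  obtain ⟨L, d, hL, hd, hXeq, hsign, hneg, hfill⟩ := stieltjes_ldl hX hZ
  refine ⟨L, d, hL, hd, hXeq, hsign, ?_, ?_⟩
  · have hne : (Finset.univ : Finset ι).Nonempty :=
      Finset.univ_nonempty_iff.mpr hconn.nonempty
    obtain ⟨a, -, ha⟩ := Finset.exists_mem_eq_sup (Finset.univ : Finset ι) hne
      fun v => (higherAdj (elimGraph (matrixGraph X)).Adj v).ncard
    refine ⟨a, ?_⟩
    have hset : ({i | a < i ∧ L i a ≠ 0} : Set ι) = higherAdj (elimGraph (matrixGraph X)).Adj a := by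
      ext i
      rw [mem_higherAdj_iff]
      exact ⟨fun ⟨h1, h2⟩ => ⟨h1, (hfill i a h1).mp h2⟩, fun ⟨h1, h2⟩ => ⟨h1, (hfill i a h1).mpr h2⟩⟩
    rw [hset, ← ha]
    exact le_elimWidth_of_isoperimetry hconn Δ w hΔ h3 hiso
  · obtain ⟨K, hK, hKc⟩ := exists_isClique_elimGraph_of_isoperimetry hconn Δ w hΔ h3 hiso
    exact ⟨K, hK, fun a ha i hi hai => (hneg i a hai).mpr (hKc ha hi hai.ne)⟩

end Abstract

/-! ## 2. The massive free field on the torus is a Stieltjes matrix with the torus graph -/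

section FreeField

variable {d L : ℕ}

/-- The precision matrix `-Δ + m²` of the massive lattice free field on `(ℤ/L)^d`: graph Laplacian
of the torus graph plus `m²·1`. [folklore] -/
def freeFieldPrecision (d L : ℕ) [NeZero L] (m : ℝ) : Matrix (TorusSite d L) (TorusSite d L) ℝ :=
  (torusGraph d L).lapMatrix ℝ + m ^ 2 • (1 : Matrix (TorusSite d L) (TorusSite d L) ℝ)

/-- Off-diagonal entries of `-Δ + m²`: `-1` on torus edges, `0` otherwise. [folklore] -/
theorem freeFieldPrecision_apply_of_ne [NeZero L] (m : ℝ) {i j : TorusSite d L} (hij : i ≠ j) :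
    freeFieldPrecision d L m i j = if (torusGraph d L).Adj i j then -1 else 0 := by
  rw [freeFieldPrecision, Matrix.add_apply, SimpleGraph.lapMatrix, Matrix.sub_apply,
    SimpleGraph.degMatrix, Matrix.diagonal_apply_ne _ hij, SimpleGraph.adjMatrix_apply,
    Matrix.smul_apply, Matrix.one_apply_ne hij, smul_zero, add_zero, zero_sub]
  split_ifs <;> simp

/-- `-Δ + m²` is positive definite for `m ≠ 0`. [folklore] -/
theorem posDef_freeFieldPrecision [NeZero L] {m : ℝ} (hm : m ≠ 0) :
    (freeFieldPrecision d L m).PosDef := by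
  rw [freeFieldPrecision, add_comm]
  refine Matrix.PosDef.add_posSemidef ?_ (SimpleGraph.posSemidef_lapMatrix ℝ (torusGraph d L))
  rw [Matrix.smul_one_eq_diagonal]
  exact Matrix.posDef_diagonal_iff.mpr fun _ => by positivity

/-- `-Δ + m²` is a Z-matrix (a STIELTJES matrix). [folklore] -/
theorem isZMatrix_freeFieldPrecision [NeZero L] (m : ℝ) : IsZMatrix (freeFieldPrecision d L m) := by
  intro i j hij
  rw [freeFieldPrecision_apply_of_ne m hij]
  split_ifs <;> norm_num

/-- The graph of `-Δ + m²` is the torus graph. [folklore] -/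
theorem matrixGraph_freeFieldPrecision [NeZero L] (m : ℝ) :
    matrixGraph (freeFieldPrecision d L m) = torusGraph d L := by
  ext i j
  change (i ≠ j ∧ (freeFieldPrecision d L m i j ≠ 0 ∨ freeFieldPrecision d L m j i ≠ 0)) ↔ _
  by_cases hij : i = j
  · subst hij; simp
  · rw [freeFieldPrecision_apply_of_ne m hij, freeFieldPrecision_apply_of_ne m (Ne.symm hij)]
    by_cases h : (torusGraph d L).Adj i j
    · have h' : (torusGraph d L).Adj j i := h.symm
      simp [h, h', hij]
    · have h' : ¬ (torusGraph d L).Adj j i := fun h'' => h h''.symm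
      simp [h, h', hij]

end FreeField

/-! ## 3. The law -/

section Law

variable {d L : ℕ} [NeZero L] [LinearOrder (TorusSite d L)]

/-- **THE AUTOREGRESSIVE-CONTEXT VOLUME LAW FOR THE LATTICE FREE FIELD** (`d ≥ 2`, `L ≥ 2`,
`m ≠ 0`, ANY linear order of the sites of `(ℤ/L)^d`).  The Cholesky factorisation
`-Δ + m² = L·diag(dv)·Lᵀ` (`L` unit lower triangular, `dv > 0`; the exact autoregressive sampler
generating the largest site first has `x_a | x_{≻a} ~ N(-Σ_{i≻a} L_{ia} x_i, 1/dv_a)`) satisfies: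
(i) `L_{ia} ≤ 0` off the diagonal; (ii) for `a ≺ i`, `L_{ia} ≠ 0` iff `{a,i}` is a fill edge of
the torus graph in this order; (iii) SOME site `a` has context
`#{i ≻ a | L_{ia} ≠ 0} ≥ c_d·L^{d-1}`; (iv) there is a set `K` of `≥ c_d·L^{d-1}` sites with
`L_{ia} < 0` for ALL `a ≺ i` in `K` (every earlier-generated site of `K` is read by every later
one). [folklore] -/
theorem freeField_context_law (hd : 2 ≤ d) (hL : 2 ≤ L) {m : ℝ} (hm : m ≠ 0) :
    ∃ (Lc : Matrix (TorusSite d L) (TorusSite d L) ℝ) (dv : TorusSite d L → ℝ),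
      IsUnitLowerTriangular Lc ∧ (∀ a, 0 < dv a) ∧
      freeFieldPrecision d L m = Lc * diagonal dv * Lcᵀ ∧
      (∀ i a, i ≠ a → Lc i a ≤ 0) ∧
      (∀ i a, a < i → (Lc i a ≠ 0 ↔ (elimGraph (torusGraph d L)).Adj a i)) ∧
      (∃ a, isoConst d (1 / (8 * d)) * (L : ℝ) ^ (d - 1) ≤
        ({i | a < i ∧ Lc i a ≠ 0} : Set (TorusSite d L)).ncard) ∧
      (∃ K : Finset (TorusSite d L), isoConst d (1 / (8 * d)) * (L : ℝ) ^ (d - 1) ≤ K.card ∧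
        ∀ a ∈ K, ∀ i ∈ K, a < i → Lc i a < 0) := by
  classical
  obtain ⟨Lc, dv, hLc, hdv, hQ, hsign, hneg, hfill⟩ :=
    stieltjes_ldl (posDef_freeFieldPrecision (d := d) (L := L) hm) (isZMatrix_freeFieldPrecision m)
  rw [matrixGraph_freeFieldPrecision] at hneg hfill
  refine ⟨Lc, dv, hLc, hdv, by convert hQ, hsign, hfill, ?_, ?_⟩
  · -- a site attaining the elimination width
    obtain ⟨a, -, ha⟩ := Finset.exists_mem_eq_sup (univ : Finset (TorusSite d L)) univ_nonempty
      fun v => (higherAdj (elimGraph (torusGraph d L)).Adj v).ncard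
    refine ⟨a, ?_⟩
    have hset : ({i | a < i ∧ Lc i a ≠ 0} : Set (TorusSite d L)) =
        higherAdj (elimGraph (torusGraph d L)).Adj a := by
      ext i
      rw [mem_higherAdj_iff]
      exact ⟨fun ⟨h1, h2⟩ => ⟨h1, (hfill i a h1).mp h2⟩, fun ⟨h1, h2⟩ => ⟨h1, (hfill i a h1).mpr h2⟩⟩
    rw [hset, ← ha]
    exact torus_le_elimWidth hd hL inferInstance
  · obtain ⟨K, hK, hKc⟩ := torus_exists_isClique_elimGraph hd hL
      (inferInstance : LinearOrder (TorusSite d L))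
    exact ⟨K, hK, fun a ha i hi hai => (hneg i a hai).mpr (hKc ha hi hai.ne)⟩

end Law

/-! ## 4. The matching upper bound: the folded raster order -/

section Upper

variable {d L : ℕ} [NeZero L]

/-- **THE LAW IS SHARP IN THE EXPONENT**: in the FOLDED RASTER order of the sites
(`Scaling/EliminationFrontRaster.lean`) the exact autoregressive sampler of `-Δ + m²` reads at most
`2·L^{d-1}` earlier sites at EVERY site (`L ≥ 2`, `m ≠ 0`) — so the minimal largest context over
all orderings is `Θ(L^{d-1})`, a full cross-section of the lattice. [folklore] -/
theorem freeField_context_foldedRaster_le (hL : 2 ≤ L) {m : ℝ} (hm : m ≠ 0) :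
    letI : LinearOrder (TorusSite d L) := foldedRasterOrder d L
    ∃ (Lc : Matrix (TorusSite d L) (TorusSite d L) ℝ) (dv : TorusSite d L → ℝ),
      IsUnitLowerTriangular Lc ∧ (∀ a, 0 < dv a) ∧
      freeFieldPrecision d L m = Lc * diagonal dv * Lcᵀ ∧
      ∀ a, ({i | a < i ∧ Lc i a ≠ 0} : Set (TorusSite d L)).ncard ≤ 2 * L ^ (d - 1) := by
  letI : LinearOrder (TorusSite d L) := foldedRasterOrder d L
  obtain ⟨Lc, dv, hLc, hdv, hQ, -, -, hfill⟩ :=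
    stieltjes_ldl (posDef_freeFieldPrecision (d := d) (L := L) hm) (isZMatrix_freeFieldPrecision m)
  rw [matrixGraph_freeFieldPrecision] at hfill
  refine ⟨Lc, dv, hLc, hdv, by convert hQ, fun a => ?_⟩
  have hset : ({i | a < i ∧ Lc i a ≠ 0} : Set (TorusSite d L)) =
      higherAdj (elimGraph (torusGraph d L)).Adj a := by
    ext i
    rw [mem_higherAdj_iff]
    exact ⟨fun ⟨h1, h2⟩ => ⟨h1, (hfill i a h1).mp h2⟩, fun ⟨h1, h2⟩ => ⟨h1, (hfill i a h1).mpr h2⟩⟩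
  rw [hset]
  exact (ncard_higherAdj_elimGraph_le_elimWidth a).trans (torus_elimWidth_foldedRaster_le hL)

/-- **THE TREEWIDTH OF THE TORUS IS A CROSS-SECTION, TWO-SIDED**: for `d ≥ 2`, `L ≥ 2`,
`c_d·L^{d-1} ≤ tw((ℤ/L)^d) ≤ 2·L^{d-1}` (`Scaling/EliminationFrontTorus.lean` and
`Scaling/EliminationFrontRaster.lean`). [folklore] -/
theorem torus_treewidth_two_sided (hd : 2 ≤ d) (hL : 2 ≤ L) :
    isoConst d (1 / (8 * d)) * (L : ℝ) ^ (d - 1) ≤ (treewidth (torusGraph d L) : ℝ) ∧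
      treewidth (torusGraph d L) ≤ 2 * L ^ (d - 1) :=
  ⟨torus_le_treewidth hd hL, torus_treewidth_le hL⟩

end Upper

end Summit.Ventures.LatticeQCDFlow.Theory2.Autoregressive
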